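import Mathlib
import Summits.KontsevichZagierPeriods.KontsevichZagierPeriods.Theorems.SoloInformedLemniscateSector
import Summits.KontsevichZagierPeriods.KontsevichZagierPeriods.Theorems.SoloInformedTorsionFree
import HarnessLib
import HarnessLib.Audit

/-!
# SoloInformed — Euler's family of quadratic Beta relations inside the rules (Theorem IX′)

For every positive rational `a = p/q`, Euler's relation

  `B(a,½) · B(a+½,½) = π / a`        (`Γ(a)√π/Γ(a+½) · Γ(a+½)√π/Γ(a+1) = π/a`)

is DERIVED inside the Kontsevich–Zagier calculus: in the formal period ring `P`,
`p · ⟦β(a,½)⟧ · ⟦β(a+½,½)⟧ = q · ⟦[disc, 1]⟧` (`soloInformed_euler_beta_family`; Dirichlet's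
re-association at `(a,½,½)`, the disc peeling `⟦β(½,½)⟧ = ⟦π⟧`, `β(a,1) ∼ [pt, 1/a]`, and the
arithmetic of point representations `⟦[pt,x]⟧·⟦[pt,y]⟧ = ⟦[pt,xy]⟧`, `⟦[pt,k]⟧ = k`).  The case
`a = ¼` is Euler's lemniscate relation (Theorem IX, `SoloInformedLemniscateSector.lean`).

**Theorem IX′** (`soloInformed_kzp_on_eulerSector`). *For every rational `a > 0` such that `B(a,½)`
and `π` are algebraically independent over `ℚ`, the Kontsevich–Zagier conjecture holds on the Euler
sector `ℤ[⟦β(a,½)⟧, ⟦β(a+½,½)⟧, ⟦π⟧] ⊆ P`: evaluation is injective there, two representations with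
classes in the sector and equal values are equivalent, and every integer polynomial relation among
`B(a,½), B(a+½,½), π` is derivable by the moves.*  The hypothesis is Grothendieck's period
conjecture for the part of the Fermat motive of exponent `2q` carrying `B(a,½)`; it is a THEOREM
for `a ∈ ¼ + ½ℤ` (Chudnovsky: `π, Γ(¼)`) — instance `soloInformed_kzp_on_eulerSector_threeQuarter`,
the sector `ℤ[⟦β(¾,½)⟧, ⟦β(5/4,½)⟧, ⟦π⟧]`, unconditional — and for `a ∈ ⅓ + ½ℤ`, `⅙ + ½ℤ`
(Chudnovsky: `π, Γ(⅓)`; sequel file).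

Also the general saturation lemma `soloInformed_pow_mul_mem_adjoin_pair_of_mem`; that every positive
integer is a unit of `P` is `soloInformed_isUnit_natCast` (`SoloInformedTorsionFree.lean`).
Residency `solo-KontsevichZagierPeriods-informed` (s22); paper §6octies.

References: L. Euler, E321/E605; G. E. Andrews, R. Askey, R. Roy, *Special functions* (1999),
Thm. 1.8.1 and §1.5; M. Kontsevich, D. Zagier, *Periods* (2001), §1.1 (6), §1.2; G. V. Chudnovsky
(1984), Ch. 7.
-/

noncomputable section

open MeasureTheory Set Filter
namespace Summit.KontsevichZagierPeriods.KontsevichZagierPeriods.Theorems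

open Literature.NumberTheory.Transcendental Literature.NumberTheory.Transcendental.KZ
open Literature.ModelTheory.ExponentialFields

/-! ### Point representations: `x ↦ ⟦[pt, x]⟧` is multiplicative -/

/-- **`⟦[pt, x]⟧ · ⟦[pt, y]⟧ = ⟦[pt, xy]⟧`** for real algebraic constants: the Fubini product of two
point representations is the point representation with the product constant (same domain `ℝ⁰`,
same integrand; rule 1). [Kontsevich–Zagier 2001, §4.1] -/
theorem soloInformed_pointRep_mul (x y : ℝ) (hx : IsAlgebraic ℚ x) (hy : IsAlgebraic ℚ y)
    (hxy : IsAlgebraic ℚ (x * y)) :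
    toFormalPeriod (of (IntegralRep.unit.constMul x hx)) *
      toFormalPeriod (of (IntegralRep.unit.constMul y hy)) =
        toFormalPeriod (of (IntegralRep.unit.constMul (x * y) hxy)) := by
  rw [toFormalPeriod_of_mul_of]
  apply toFormalPeriod_eq_iff.mpr
  refine of_sub_of_mem_relations_of_eqOn ?_ fun z _ => ?_
  · ext z
    simp [IntegralRep.prodDomain, IntegralRep.constMul]
  · rw [IntegralRep.prod_integrand_eq]
    simp [IntegralRep.prodFun, IntegralRep.constMul]

/-- **Saturation lemma**: if `d ∈ ℤ[u,v]` and `d·w ∈ ℤ[u,v]`, every `x ∈ ℤ[u,v,w]` has a multiple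
`dᴺ·x ∈ ℤ[u,v]`. [folklore] -/
theorem soloInformed_pow_mul_mem_adjoin_pair_of_mem {u v w d : FormalPeriodRing}
    (hd : d ∈ Algebra.adjoin ℤ ({u, v} : Set FormalPeriodRing))
    (hdw : d * w ∈ Algebra.adjoin ℤ ({u, v} : Set FormalPeriodRing))
    {x : FormalPeriodRing} (hx : x ∈ Algebra.adjoin ℤ ({u, v, w} : Set FormalPeriodRing)) :
    ∃ N : ℕ, d ^ N * x ∈ Algebra.adjoin ℤ ({u, v} : Set FormalPeriodRing) := by
  induction hx using Algebra.adjoin_induction with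
  | mem y hy =>
    rcases hy with rfl | rfl | rfl
    · exact ⟨0, by simpa using Algebra.subset_adjoin (by simp)⟩
    · exact ⟨0, by simpa using Algebra.subset_adjoin (by simp)⟩
    · exact ⟨1, by rw [pow_one]; exact hdw⟩
  | algebraMap r => exact ⟨0, by rw [pow_zero, one_mul]; exact Subalgebra.algebraMap_mem _ r⟩
  | add y z _ _ hy hz =>
    obtain ⟨N₁, h₁⟩ := hy
    obtain ⟨N₂, h₂⟩ := hz
    refine ⟨N₁ + N₂, ?_⟩
    have : d ^ (N₁ + N₂) * (y + z) = d ^ N₂ * (d ^ N₁ * y) + d ^ N₁ * (d ^ N₂ * z) := by ring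
    rw [this]
    exact add_mem (mul_mem (pow_mem hd N₂) h₁) (mul_mem (pow_mem hd N₁) h₂)
  | mul y z _ _ hy hz =>
    obtain ⟨N₁, h₁⟩ := hy
    obtain ⟨N₂, h₂⟩ := hz
    refine ⟨N₁ + N₂, ?_⟩
    have : d ^ (N₁ + N₂) * (y * z) = (d ^ N₁ * y) * (d ^ N₂ * z) := by ring
    rw [this]
    exact mul_mem h₁ h₂

/-! ### Euler's family `p·⟦β(a,½)⟧⟦β(a+½,½)⟧ = q·⟦π⟧`, `a = p/q` -/

section Family

variable (p q : ℕ) (B B' : IntegralRep 1)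

/-- **Euler's family of quadratic Beta relations inside the rules**: for `a = p/q > 0` and
representations pinned as `B = β(a,½) = [(0,1), t^{a−1}(1−t)^{−1/2}]`, `B' = β(a+½,½)`,
`p · ⟦B⟧ · ⟦B'⟧ = q · ⟦[disc,1]⟧` in `P`.  Chain: Dirichlet at `(a,½,½)`:
`⟦β(a,½)⟧⟦β(a+½,½)⟧ = ⟦β(½,½)⟧⟦β(a,1)⟧`; `⟦β(½,½)⟧ = ⟦π⟧`; `β(a,1) ∼ [pt, 1/a]`;
`p·⟦[pt,1/a]⟧ = ⟦[pt,p]⟧⟦[pt,q/p]⟧ = ⟦[pt,q]⟧ = q`.  Value: `B(a,½)B(a+½,½) = π/a`.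
[Euler E321; Andrews–Askey–Roy 1999, §1.5, Thm. 1.8.1; Kontsevich–Zagier 2001, §1.1 (6)] -/
theorem soloInformed_euler_beta_family (hp : 0 < p) (hq : 0 < q)
    (hBd : B.domain = {t | t 0 ∈ Set.Ioo (0:ℝ) 1})
    (hBi : Set.EqOn B.integrand
      (fun t => (t 0) ^ ((((p : ℚ) / q : ℚ) : ℝ) - 1) *
        (1 - t 0) ^ (((1 / 2 : ℚ) : ℝ) - 1)) B.domain)
    (hB'd : B'.domain = {t | t 0 ∈ Set.Ioo (0:ℝ) 1})
    (hB'i : Set.EqOn B'.integrand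
      (fun t => (t 0) ^ ((((p : ℚ) / q + 1 / 2 : ℚ) : ℝ) - 1) *
        (1 - t 0) ^ (((1 / 2 : ℚ) : ℝ) - 1)) B'.domain) :
    (p : FormalPeriodRing) * (toFormalPeriod (of B) * toFormalPeriod (of B')) =
      (q : FormalPeriodRing) * toFormalPeriod (of KZ.piRep) := by
  set a : ℚ := (p : ℚ) / q with ha_def
  have ha : 0 < a := by rw [ha_def]; positivity
  have hh : (0 : ℚ) < 1 / 2 := by norm_num
  obtain ⟨H, hHd, hHi⟩ := exists_betaRep' (1 / 2) (1 / 2) hh hh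
  obtain ⟨L, hLd, hLi⟩ := exists_betaRep' a 1 ha one_pos
  have hdir := soloInformed_dirichlet_reassociation a (1 / 2) (1 / 2) ha hh hh B B' H L
    hBd hBi hB'd hB'i hHd (fun t _ => by rw [hHi]) hLd (fun t _ => by rw [hLi]; norm_num)
  have hainv : IsAlgebraic ℚ ((a : ℝ)⁻¹) := by
    rw [← Rat.cast_inv]
    exact isAlgebraic_algebraMap _
  have hL : toFormalPeriod (of L) =
      toFormalPeriod (of (IntegralRep.unit.constMul ((a : ℝ)⁻¹) hainv)) :=
    (betaFirst_equivalent_unit_constMul a ha L hLd (fun t _ => by rw [hLi]) hainv).toFormalPeriod_eq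
  have hH : toFormalPeriod (of H) = toFormalPeriod (of KZ.piRep) :=
    (soloInformed_toFormalPeriod_piRep_eq_betaHalf H hHd (fun t _ => by rw [hHi])).symm
  -- `p · ⟦[pt, 1/a]⟧ = q`
  have key : ∀ (x : ℝ) (hx : IsAlgebraic ℚ x), x = ((q : ℕ) : ℝ) →
      toFormalPeriod (of (IntegralRep.unit.constMul x hx)) = (q : FormalPeriodRing) := by
    rintro x hx rfl
    exact toFormalPeriod_of_unit_constMul_natCast q hx
  have hq0 : (q : ℝ) ≠ 0 := by exact_mod_cast hq.ne'
  have hp0 : (p : ℝ) ≠ 0 := by exact_mod_cast hp.ne'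
  have hxq : (p : ℝ) * ((a : ℝ))⁻¹ = ((q : ℕ) : ℝ) := by
    rw [ha_def]
    push_cast
    field_simp
  have hxalg : IsAlgebraic ℚ ((p : ℝ) * ((a : ℝ))⁻¹) := by
    rw [hxq]
    exact isAlgebraic_nat q
  have hpa : (p : FormalPeriodRing) *
      toFormalPeriod (of (IntegralRep.unit.constMul ((a : ℝ)⁻¹) hainv)) = q := by
    rw [← toFormalPeriod_of_unit_constMul_natCast p (isAlgebraic_nat p),
      soloInformed_pointRep_mul _ _ (isAlgebraic_nat p) hainv hxalg]
    exact key _ hxalg hxq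
  calc (p : FormalPeriodRing) * (toFormalPeriod (of B) * toFormalPeriod (of B'))
      = toFormalPeriod (of H) * ((p : FormalPeriodRing) * toFormalPeriod (of L)) := by
        rw [hdir]; ring
    _ = toFormalPeriod (of KZ.piRep) * q := by rw [hL, hpa, hH]
    _ = (q : FormalPeriodRing) * toFormalPeriod (of KZ.piRep) := by ring

/-- **Value shadow**: `p · B(a,½) · B(a+½,½) = q · π` for `a = p/q`. [Euler E321] -/
theorem soloInformed_value_euler_beta_family (hp : 0 < p) (hq : 0 < q)
    (hBd : B.domain = {t | t 0 ∈ Set.Ioo (0:ℝ) 1})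
    (hBi : Set.EqOn B.integrand
      (fun t => (t 0) ^ ((((p : ℚ) / q : ℚ) : ℝ) - 1) *
        (1 - t 0) ^ (((1 / 2 : ℚ) : ℝ) - 1)) B.domain)
    (hB'd : B'.domain = {t | t 0 ∈ Set.Ioo (0:ℝ) 1})
    (hB'i : Set.EqOn B'.integrand
      (fun t => (t 0) ^ ((((p : ℚ) / q + 1 / 2 : ℚ) : ℝ) - 1) *
        (1 - t 0) ^ (((1 / 2 : ℚ) : ℝ) - 1)) B'.domain) :
    (p : ℝ) * (B.value * B'.value) = q * Real.pi := by
  have h := congr_arg evalP (soloInformed_euler_beta_family p q B B' hp hq hBd hBi hB'd hB'i)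
  simpa only [map_mul, evalP_toFormalPeriod_of, piRep_value, map_natCast] using h

/-! ### The Euler sector `ℤ[⟦β(a,½)⟧, ⟦β(a+½,½)⟧, ⟦π⟧]` is decided when `B(a,½), π` are
algebraically independent -/

/-- **`B(a,½)` and `B(a+½,½)` are algebraically independent** as soon as `B(a,½)` and `π` are:
`π = (p/q)·B·B' ∈ ℚ(B, B')`.
[Chudnovsky 1984, Ch. 7 (the hypothesis, for `a ∈ ¼+½ℤ, ⅓+½ℤ, ⅙+½ℤ`)] -/
theorem soloInformed_algebraicIndependent_euler_pair (hp : 0 < p) (hq : 0 < q)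
    (hBd : B.domain = {t | t 0 ∈ Set.Ioo (0:ℝ) 1})
    (hBi : Set.EqOn B.integrand
      (fun t => (t 0) ^ ((((p : ℚ) / q : ℚ) : ℝ) - 1) *
        (1 - t 0) ^ (((1 / 2 : ℚ) : ℝ) - 1)) B.domain)
    (hB'd : B'.domain = {t | t 0 ∈ Set.Ioo (0:ℝ) 1})
    (hB'i : Set.EqOn B'.integrand
      (fun t => (t 0) ^ ((((p : ℚ) / q + 1 / 2 : ℚ) : ℝ) - 1) *
        (1 - t 0) ^ (((1 / 2 : ℚ) : ℝ) - 1)) B'.domain)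
    (hind : AlgebraicIndependent ℚ ![B.value, Real.pi]) :
    AlgebraicIndependent ℚ ![B.value, B'.value] := by
  have hval := soloInformed_value_euler_beta_family p q B B' hp hq hBd hBi hB'd hB'i
  set K : IntermediateField ℚ ℝ := IntermediateField.adjoin ℚ ({B.value, B'.value} : Set ℝ)
    with hK
  have h1K : B.value ∈ K := IntermediateField.subset_adjoin ℚ _ (by simp)
  have h2K : B'.value ∈ K := IntermediateField.subset_adjoin ℚ _ (by simp)
  have hq0 : (q : ℝ) ≠ 0 := by exact_mod_cast hq.ne'
  refine soloInformed_algebraicIndependent_pair_transfer hind ⟨1, one_pos, by simpa using h1K⟩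
    ⟨1, one_pos, ?_⟩
  rw [pow_one, show Real.pi = (p : ℝ) * (B.value * B'.value) / q by
    rw [hval]; field_simp]
  exact div_mem (mul_mem (by exact_mod_cast K.natCast_mem p) (mul_mem h1K h2K))
    (by exact_mod_cast K.natCast_mem q)

/-- **Evaluation is injective on the Euler sector** `ℤ[⟦β(a,½)⟧, ⟦β(a+½,½)⟧, ⟦π⟧]`, granted that
`B(a,½)` and `π` are algebraically independent over `ℚ`. -/
theorem soloInformed_evalP_eq_zero_of_mem_eulerSector (hp : 0 < p) (hq : 0 < q)
    (hBd : B.domain = {t | t 0 ∈ Set.Ioo (0:ℝ) 1})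
    (hBi : Set.EqOn B.integrand
      (fun t => (t 0) ^ ((((p : ℚ) / q : ℚ) : ℝ) - 1) *
        (1 - t 0) ^ (((1 / 2 : ℚ) : ℝ) - 1)) B.domain)
    (hB'd : B'.domain = {t | t 0 ∈ Set.Ioo (0:ℝ) 1})
    (hB'i : Set.EqOn B'.integrand
      (fun t => (t 0) ^ ((((p : ℚ) / q + 1 / 2 : ℚ) : ℝ) - 1) *
        (1 - t 0) ^ (((1 / 2 : ℚ) : ℝ) - 1)) B'.domain)
    (hind : AlgebraicIndependent ℚ ![B.value, Real.pi]) {x : FormalPeriodRing}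
    (hx : x ∈ Algebra.adjoin ℤ
      ({toFormalPeriod (of B), toFormalPeriod (of B'), toFormalPeriod (of KZ.piRep)} :
        Set FormalPeriodRing))
    (h0 : evalP x = 0) : x = 0 := by
  have hfam := soloInformed_euler_beta_family p q B B' hp hq hBd hBi hB'd hB'i
  have hqmem : (q : FormalPeriodRing) ∈
      Algebra.adjoin ℤ ({toFormalPeriod (of B), toFormalPeriod (of B')} : Set FormalPeriodRing) :=
    natCast_mem _ q
  have hqw : (q : FormalPeriodRing) * toFormalPeriod (of KZ.piRep) ∈
      Algebra.adjoin ℤ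
        ({toFormalPeriod (of B), toFormalPeriod (of B')} : Set FormalPeriodRing) := by
    rw [← hfam]
    exact mul_mem (natCast_mem _ p) (mul_mem (Algebra.subset_adjoin (by simp))
      (Algebra.subset_adjoin (by simp)))
  obtain ⟨N, hN⟩ := soloInformed_pow_mul_mem_adjoin_pair_of_mem hqmem hqw hx
  have hind2 : AlgebraicIndependent ℚ
      ![evalP (toFormalPeriod (of B)), evalP (toFormalPeriod (of B'))] := by
    rw [evalP_toFormalPeriod_of, evalP_toFormalPeriod_of]
    exact soloInformed_algebraicIndependent_euler_pair p q B B' hp hq hBd hBi hB'd hB'i hind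
  have h4 : evalP ((q : FormalPeriodRing) ^ N * x) = 0 := by rw [map_mul, h0, mul_zero]
  have h5 := soloInformed_evalP_eq_zero_of_mem_adjoin_pair hind2 hN h4
  exact ((soloInformed_isUnit_natCast hq.ne').pow N).mul_right_eq_zero.mp h5

/-- **Theorem IX′ — the Kontsevich–Zagier conjecture on the Euler sector**
`ℤ[⟦β(a,½)⟧, ⟦β(a+½,½)⟧, ⟦π⟧]`, `a = p/q > 0`, granted that `B(a,½)` and `π` are algebraically
independent: representations of any dimensions with classes in the sector and equal values are
equivalent under the moves. [Kontsevich–Zagier 2001, §1.2, Conjecture 1 — this sector] -/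
theorem soloInformed_kzp_on_eulerSector (hp : 0 < p) (hq : 0 < q)
    (hBd : B.domain = {t | t 0 ∈ Set.Ioo (0:ℝ) 1})
    (hBi : Set.EqOn B.integrand
      (fun t => (t 0) ^ ((((p : ℚ) / q : ℚ) : ℝ) - 1) *
        (1 - t 0) ^ (((1 / 2 : ℚ) : ℝ) - 1)) B.domain)
    (hB'd : B'.domain = {t | t 0 ∈ Set.Ioo (0:ℝ) 1})
    (hB'i : Set.EqOn B'.integrand
      (fun t => (t 0) ^ ((((p : ℚ) / q + 1 / 2 : ℚ) : ℝ) - 1) *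
        (1 - t 0) ^ (((1 / 2 : ℚ) : ℝ) - 1)) B'.domain)
    (hind : AlgebraicIndependent ℚ ![B.value, Real.pi])
    {n m : ℕ} (r : IntegralRep n) (r' : IntegralRep m)
    (hr : toFormalPeriod (of r) ∈ Algebra.adjoin ℤ
      ({toFormalPeriod (of B), toFormalPeriod (of B'), toFormalPeriod (of KZ.piRep)} :
        Set FormalPeriodRing))
    (hr' : toFormalPeriod (of r') ∈ Algebra.adjoin ℤ
      ({toFormalPeriod (of B), toFormalPeriod (of B'), toFormalPeriod (of KZ.piRep)} :
        Set FormalPeriodRing))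
    (hv : r.value = r'.value) : Equivalent r r' := by
  have hx := sub_mem hr hr'
  have h0 : evalP (toFormalPeriod (of r) - toFormalPeriod (of r')) = 0 := by
    rw [map_sub, evalP_toFormalPeriod_of, evalP_toFormalPeriod_of, hv, sub_self]
  have h :=
    soloInformed_evalP_eq_zero_of_mem_eulerSector p q B B' hp hq hBd hBi hB'd hB'i hind hx h0
  exact toFormalPeriod_eq_iff.mp (sub_eq_zero.mp h)

/-- **Every integer polynomial relation among `B(a,½), B(a+½,½), π` is derivable by the moves**,
granted the algebraic independence of `B(a,½), π`: the relation ideal of the Euler sector is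
generated, up to saturation at `q ∈ Pˣ`, by Euler's relation `pXY − qZ`. -/
theorem soloInformed_eulerSector_relation_derivable (hp : 0 < p) (hq : 0 < q)
    (hBd : B.domain = {t | t 0 ∈ Set.Ioo (0:ℝ) 1})
    (hBi : Set.EqOn B.integrand
      (fun t => (t 0) ^ ((((p : ℚ) / q : ℚ) : ℝ) - 1) *
        (1 - t 0) ^ (((1 / 2 : ℚ) : ℝ) - 1)) B.domain)
    (hB'd : B'.domain = {t | t 0 ∈ Set.Ioo (0:ℝ) 1})
    (hB'i : Set.EqOn B'.integrand
      (fun t => (t 0) ^ ((((p : ℚ) / q + 1 / 2 : ℚ) : ℝ) - 1) *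
        (1 - t 0) ^ (((1 / 2 : ℚ) : ℝ) - 1)) B'.domain)
    (hind : AlgebraicIndependent ℚ ![B.value, Real.pi])
    (f : MvPolynomial (Fin 3) ℤ) (hf : MvPolynomial.aeval ![B.value, B'.value, Real.pi] f = 0) :
    MvPolynomial.aeval
      ![toFormalPeriod (of B), toFormalPeriod (of B'), toFormalPeriod (of KZ.piRep)] f = 0 := by
  set c : Fin 3 → FormalPeriodRing :=
    ![toFormalPeriod (of B), toFormalPeriod (of B'), toFormalPeriod (of KZ.piRep)] with hc
  have hmem : MvPolynomial.aeval c f ∈ Algebra.adjoin ℤ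
      ({toFormalPeriod (of B), toFormalPeriod (of B'), toFormalPeriod (of KZ.piRep)} :
        Set FormalPeriodRing) := by
    have h1 : MvPolynomial.aeval c f ∈ Algebra.adjoin ℤ (Set.range c) := by
      rw [Algebra.adjoin_range_eq_range_aeval]
      exact ⟨f, rfl⟩
    refine Algebra.adjoin_mono ?_ h1
    rintro _ ⟨i, rfl⟩
    fin_cases i <;> simp [hc]
  refine soloInformed_evalP_eq_zero_of_mem_eulerSector p q B B' hp hq hBd hBi hB'd hB'i hind hmem ?_
  have hfun : (fun i => evalP (c i)) = ![B.value, B'.value, Real.pi] := by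
    ext i; fin_cases i <;> simp [hc, piRep_value]
  rw [soloInformed_evalP_aeval, hfun, hf]

end Family

/-! ### The unconditional instance `a = ¾`: the sector `ℤ[⟦β(¾,½)⟧, ⟦β(5/4,½)⟧, ⟦π⟧]` -/

/-- **`B(¾,½)` and `π` are algebraically independent** (`B(¾,½) = 4π/B(¼,½)`; Chudnovsky).
[Chudnovsky 1984, Ch. 7, Cor. 2.3] -/
theorem soloInformed_algebraicIndependent_betaThreeQuarterHalf_pi (B₃ : IntegralRep 1)
    (h₃d : B₃.domain = {t | t 0 ∈ Set.Ioo (0:ℝ) 1})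
    (h₃i : Set.EqOn B₃.integrand
      (fun t => (t 0) ^ (((3 / 4 : ℚ) : ℝ) - 1) *
        (1 - t 0) ^ (((1 / 2 : ℚ) : ℝ) - 1)) B₃.domain) :
    AlgebraicIndependent ℚ ![B₃.value, Real.pi] := by
  have hq : (0 : ℚ) < 1 / 4 := by norm_num
  have hh : (0 : ℚ) < 1 / 2 := by norm_num
  obtain ⟨B₁, h₁d, h₁i⟩ := exists_betaRep' (1 / 4) (1 / 2) hq hh
  have h₁i' : Set.EqOn B₁.integrand
      (fun t => (t 0) ^ (((1 / 4 : ℚ) : ℝ) - 1) *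
        (1 - t 0) ^ (((1 / 2 : ℚ) : ℝ) - 1)) B₁.domain :=
    fun t _ => by rw [h₁i]
  have hind := soloInformed_algebraicIndependent_betaQuarter_betaThreeQuarter B₁ B₃ h₁d h₁i' h₃d h₃i
  have hprod := soloInformed_value_betaQuarter_mul_value_betaThreeQuarter B₁ B₃ h₁d h₁i' h₃d h₃i
  have h3pos : 0 < B₃.value := by
    have h1pos := soloInformed_value_betaQuarterHalf_pos B₁ h₁d h₁i'
    nlinarith [Real.pi_pos, h1pos]
  set K : IntermediateField ℚ ℝ := IntermediateField.adjoin ℚ ({B₃.value, Real.pi} : Set ℝ)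
    with hK
  have h3K : B₃.value ∈ K := IntermediateField.subset_adjoin ℚ _ (by simp)
  have hπK : Real.pi ∈ K := IntermediateField.subset_adjoin ℚ _ (by simp)
  refine soloInformed_algebraicIndependent_pair_transfer hind ⟨1, one_pos, ?_⟩
    ⟨1, one_pos, by simpa using h3K⟩
  rw [pow_one, show B₁.value = 4 * Real.pi / B₃.value by
    rw [← hprod]; field_simp]
  exact div_mem (mul_mem (by exact_mod_cast K.natCast_mem 4) hπK) h3K

/-- **Theorem IX′ at `a = ¾`, unconditional**: the Kontsevich–Zagier conjecture holds on the sector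
`ℤ[⟦β(¾,½)⟧, ⟦β(5/4,½)⟧, ⟦π⟧]` (derived relation `3·⟦β(¾,½)⟧⟦β(5/4,½)⟧ = 4·⟦π⟧`, value
`B(¾,½)B(5/4,½) = 4π/3`). [Kontsevich–Zagier 2001, §1.2, Conjecture 1 — this sector] -/
theorem soloInformed_kzp_on_eulerSector_threeQuarter (B B' : IntegralRep 1)
    (hBd : B.domain = {t | t 0 ∈ Set.Ioo (0:ℝ) 1})
    (hBi : Set.EqOn B.integrand
      (fun t => (t 0) ^ (((3 / 4 : ℚ) : ℝ) - 1) *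
        (1 - t 0) ^ (((1 / 2 : ℚ) : ℝ) - 1)) B.domain)
    (hB'd : B'.domain = {t | t 0 ∈ Set.Ioo (0:ℝ) 1})
    (hB'i : Set.EqOn B'.integrand
      (fun t => (t 0) ^ (((5 / 4 : ℚ) : ℝ) - 1) *
        (1 - t 0) ^ (((1 / 2 : ℚ) : ℝ) - 1)) B'.domain)
    {n m : ℕ} (r : IntegralRep n) (r' : IntegralRep m)
    (hr : toFormalPeriod (of r) ∈ Algebra.adjoin ℤ
      ({toFormalPeriod (of B), toFormalPeriod (of B'), toFormalPeriod (of KZ.piRep)} :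
        Set FormalPeriodRing))
    (hr' : toFormalPeriod (of r') ∈ Algebra.adjoin ℤ
      ({toFormalPeriod (of B), toFormalPeriod (of B'), toFormalPeriod (of KZ.piRep)} :
        Set FormalPeriodRing))
    (hv : r.value = r'.value) : Equivalent r r' := by
  have hp : (0 : ℕ) < 3 := by norm_num
  have hq : (0 : ℕ) < 4 := by norm_num
  refine soloInformed_kzp_on_eulerSector 3 4 B B' hp hq hBd (fun t ht => ?_) hB'd
    (fun t ht => ?_) (soloInformed_algebraicIndependent_betaThreeQuarterHalf_pi B hBd hBi)
    r r' hr hr' hv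
  · rw [hBi ht]; norm_num
  · rw [hB'i ht]; norm_num

end Summit.KontsevichZagierPeriods.KontsevichZagierPeriods.Theorems

end
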